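import Summits.QuantumFields.YangMills.Theorems.SmallCircleAnchorAnchorGapStubDebyeScreening6

/-!
# Crux `AnchorGap` (stmt-QuantumFields-11141), line `registered` — lattice theta sums II: flatness (soft layer under stub DSred)

Sequel of `…StubDebyeScreening6.lean`.  Main result `latticeTheta_flat`: for a basis `b` of `ℝᵏ`,
a radius `R` and `δ > 0` there is `a₀ > 0` such that

  `Θ_a(θ) ≤ (1 + δ) Θ_a(θ')`  for all `0 < a ≤ a₀`, `|θ|², |θ'|² ≤ R²`,

where `Θ_a(θ) = Σ_{n ∈ ℤᵏ} exp(−(a/2)|θ + Σ_j n_j b_j|²)`.  In the proof of stub DSred this is the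
statement that the zero-mode prior of the `ε`-regulated lattice sine-Gordon measure folded over the
dual lattice is flat on a fundamental cell as `ε N^d / g² → 0` (fixed volume, regulator removed),
so that the regulated expectations of dual-lattice-periodic observables converge, uniformly on the
parameter box, to those of the gas with compact (flat) zero mode.  Proof: Cauchy–Schwarz sandwich
`e^{−(a/2)(1+1/η)R²} Θ⁰_{a(1+η)} ≤ Θ_a(θ) ≤ e^{(a/2)R²/η} Θ⁰_{a(1−η)}` between centred sums, then
`latticeTheta_shift` with `K = κ/a` and the constants `κ(δ, k)`, `η(δ, κ)`, `a₀(δ, η, R, b)` chosen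
in this order.
-/

set_option autoImplicit false

noncomputable section

namespace Summit.QuantumFields.YangMills.Theorems.AnchorGap

open MeasureTheory Finset

/-- `2 Σ θ_c v_c ≤ η |v|² + η⁻¹ |θ|²` (complete the square). -/
private lemma two_inner_le {k : ℕ} (η : ℝ) (hη : 0 < η) (θ v : Fin k → ℝ) :
    2 * ∑ c, θ c * v c ≤ η * ∑ c, v c ^ 2 + η⁻¹ * ∑ c, θ c ^ 2 := by
  have h0 : 0 ≤ ∑ c, η⁻¹ * (η * v c - θ c) ^ 2 := sum_nonneg fun c _ => by positivity
  have hexp : ∑ c, η⁻¹ * (η * v c - θ c) ^ 2 =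
      η * ∑ c, v c ^ 2 + η⁻¹ * ∑ c, θ c ^ 2 - 2 * ∑ c, θ c * v c := by
    rw [mul_sum, mul_sum, mul_sum, ← sum_add_distrib, ← sum_sub_distrib]
    refine sum_congr rfl fun c _ => ?_
    field_simp
    ring
  linarith

/-- `2 |Σ θ_c v_c| ≤ η |v|² + η⁻¹ |θ|²` (Cauchy–Schwarz in arithmetic–geometric form). -/
private lemma two_abs_inner_le {k : ℕ} (η : ℝ) (hη : 0 < η) (θ v : Fin k → ℝ) :
    2 * |∑ c, θ c * v c| ≤ η * ∑ c, v c ^ 2 + η⁻¹ * ∑ c, θ c ^ 2 := by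
  have h1 := two_inner_le η hη θ v
  have h2 := two_inner_le η hη (fun c => -θ c) v
  simp only [neg_mul, sum_neg_distrib, mul_neg, neg_sq] at h2
  have : |∑ c, θ c * v c| ≤ (η * ∑ c, v c ^ 2 + η⁻¹ * ∑ c, θ c ^ 2) / 2 :=
    abs_le.2 ⟨by linarith, by linarith⟩
  linarith

/-- The case `δ ≤ 1` of `latticeTheta_flat`. -/
private lemma latticeTheta_flat_aux {k : ℕ} (b : Fin k → Fin k → ℝ) (hb : LinearIndependent ℝ b)
    (R δ : ℝ) (hδ : 0 < δ) (hδ1 : δ ≤ 1) :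
    ∃ a₀ : ℝ, 0 < a₀ ∧ ∀ a : ℝ, 0 < a → a ≤ a₀ → ∀ θ θ' : Fin k → ℝ,
      ∑ c : Fin k, θ c ^ 2 ≤ R ^ 2 → ∑ c : Fin k, θ' c ^ 2 ≤ R ^ 2 →
      ∑' n : Fin k → ℤ, Real.exp (-(a / 2) * ∑ c : Fin k, (θ c + ∑ j : Fin k, (n j : ℝ) * b j c) ^ 2) ≤
        (1 + δ) * ∑' n : Fin k → ℤ, Real.exp (-(a / 2) * ∑ c : Fin k, (θ' c + ∑ j : Fin k, (n j : ℝ) * b j c) ^ 2) := by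
  set Q : (Fin k → ℤ) → ℝ := fun n => ∑ c, (∑ j, (n j : ℝ) * b j c) ^ 2 with hQ
  set Bc : ℝ := ∑ c, (∑ j, |b j c|) ^ 2 with hBc
  have hBc0 : 0 ≤ Bc := sum_nonneg fun c _ => sq_nonneg _
  -- the constants `κ`, `ℓ`, `η`, `a₀`
  obtain ⟨κ, hκpos, hκexp⟩ : ∃ κ : ℝ, 0 < κ ∧ (2 : ℝ) ^ k * Real.exp 1 * Real.exp (-(κ / 8)) = δ / 8 := by
    have hlog8 : 0 < Real.log (8 / δ) := Real.log_pos (by rw [lt_div_iff₀ hδ]; linarith)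
    have hlog2 : 0 ≤ Real.log (2 ^ k) := Real.log_nonneg (one_le_pow₀ (by norm_num))
    refine ⟨8 * (Real.log (2 ^ k) + 1 + Real.log (8 / δ)), by positivity, ?_⟩
    have : -(8 * (Real.log (2 ^ k) + 1 + Real.log (8 / δ)) / 8) =
        -(Real.log (2 ^ k) + 1 + Real.log (8 / δ)) := by ring
    rw [this, Real.exp_neg, Real.exp_add, Real.exp_add, Real.exp_log (by positivity),
      Real.exp_log (by positivity)]
    field_simp
  obtain ⟨ℓ, hℓpos, hℓexp⟩ : ∃ ℓ : ℝ, 0 < ℓ ∧ Real.exp ℓ = 1 + δ / 8 :=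
    ⟨Real.log (1 + δ / 8), Real.log_pos (by linarith), Real.exp_log (by linarith)⟩
  obtain ⟨η, hηpos, hηhalf, hηκ⟩ : ∃ η : ℝ, 0 < η ∧ η ≤ 1 / 2 ∧ η * κ ≤ ℓ := by
    refine ⟨min (1 / 2) (ℓ / κ), lt_min (by norm_num) (div_pos hℓpos hκpos), min_le_left _ _, ?_⟩
    have : min (1 / 2) (ℓ / κ) ≤ ℓ / κ := min_le_right _ _
    rwa [le_div_iff₀ hκpos] at this
  have hηne : η ≠ 0 := hηpos.ne'
  refine ⟨min (4 / (Bc + 1)) (η * ℓ / ((R ^ 2 + 1) * (1 + η))), lt_min (by positivity) (by positivity),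
    fun a ha haa θ θ' hθ hθ' => ?_⟩
  have haB : a * Bc / 4 ≤ 1 := by
    have h1 : a ≤ 4 / (Bc + 1) := haa.trans (min_le_left _ _)
    rw [le_div_iff₀ (by positivity)] at h1
    nlinarith
  have haR : a * (R ^ 2 + 1) * (1 + η) ≤ η * ℓ := by
    have h1 : a ≤ η * ℓ / ((R ^ 2 + 1) * (1 + η)) := haa.trans (min_le_right _ _)
    rw [le_div_iff₀ (by positivity)] at h1
    nlinarith
  clear haa
  -- scalar estimates on the constants (done before any series enters the context)
  have hsmall : 2 ^ k * Real.exp (a * (1 - η) / 4 * Bc) * Real.exp (-((1 - η) * κ / 4)) ≤ δ / 8 := by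
    have h1 : Real.exp (a * (1 - η) / 4 * Bc) ≤ Real.exp 1 := Real.exp_le_exp.2 (by nlinarith)
    have h2 : Real.exp (-((1 - η) * κ / 4)) ≤ Real.exp (-(κ / 8)) := Real.exp_le_exp.2 (by nlinarith)
    calc 2 ^ k * Real.exp (a * (1 - η) / 4 * Bc) * Real.exp (-((1 - η) * κ / 4))
        ≤ 2 ^ k * Real.exp 1 * Real.exp (-(κ / 8)) := by gcongr
      _ = δ / 8 := hκexp
  have hηκ' : Real.exp (η * κ) ≤ 1 + δ / 8 := by
    calc Real.exp (η * κ) ≤ Real.exp ℓ := Real.exp_le_exp.2 hηκ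
      _ = 1 + δ / 8 := hℓexp
  have hRR : Real.exp (a / 2 * (η⁻¹ * R ^ 2)) * Real.exp (a / 2 * ((1 + η⁻¹) * R ^ 2)) ≤ 1 + δ / 8 := by
    rw [← Real.exp_add]
    have hx : a / 2 * (η⁻¹ * R ^ 2) + a / 2 * ((1 + η⁻¹) * R ^ 2) ≤ ℓ := by
      refine le_of_mul_le_mul_left ?_ hηpos
      have hrew : η * (a / 2 * (η⁻¹ * R ^ 2) + a / 2 * ((1 + η⁻¹) * R ^ 2)) =
          a * R ^ 2 + a * η * R ^ 2 / 2 := by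
        field_simp
        ring
      rw [hrew]
      have h1 : a * R ^ 2 ≤ a * (R ^ 2 + 1) := by nlinarith only [ha]
      have h2 : a * η * R ^ 2 / 2 ≤ a * (R ^ 2 + 1) * η := by
        nlinarith only [mul_nonneg ha.le hηpos.le, sq_nonneg R]
      linarith only [h1, h2, haR]
    calc Real.exp (a / 2 * (η⁻¹ * R ^ 2) + a / 2 * ((1 + η⁻¹) * R ^ 2)) ≤ Real.exp ℓ :=
          Real.exp_le_exp.2 hx
      _ = 1 + δ / 8 := hℓexp
  have h6 : (1 + δ / 8) * (1 + δ / 8) ≤ (1 - δ / 8) * (1 + δ) := by nlinarith only [hδ, hδ1]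
  have hδ8 : 0 < 1 - δ / 8 := by linarith only [hδ1]
  -- summability facts
  have hsum : ∀ u : ℝ, 0 < u → Summable fun n : Fin k → ℤ => Real.exp (-(u / 2) * Q n) := by
    intro u hu
    simpa [hQ] using latticeTheta_summable k b hb u hu 0
  have hsθ := latticeTheta_summable k b hb a ha θ
  have hsθ' := latticeTheta_summable k b hb a ha θ'
  -- Cauchy–Schwarz sandwich, termwise
  have hexpand : ∀ (ψ : Fin k → ℝ) (n : Fin k → ℤ),
      ∑ c, (ψ c + ∑ j, (n j : ℝ) * b j c) ^ 2 =
        ∑ c, ψ c ^ 2 + 2 * ∑ c, ψ c * (∑ j, (n j : ℝ) * b j c) + Q n := by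
    intro ψ n
    rw [hQ, mul_sum, ← sum_add_distrib, ← sum_add_distrib]
    exact sum_congr rfl fun c _ => by ring
  have hup : ∀ n : Fin k → ℤ, Real.exp (-(a / 2) * ∑ c, (θ c + ∑ j, (n j : ℝ) * b j c) ^ 2) ≤
      Real.exp (a / 2 * (η⁻¹ * R ^ 2)) * Real.exp (-(a * (1 - η) / 2) * Q n) := by
    intro n
    rw [← Real.exp_add, hexpand]
    refine Real.exp_le_exp.2 ?_
    have h1 := two_abs_inner_le η hηpos θ (fun c => ∑ j, (n j : ℝ) * b j c)
    have h2 := neg_abs_le (∑ c, θ c * ∑ j, (n j : ℝ) * b j c)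
    have h3 : η⁻¹ * ∑ c, θ c ^ 2 ≤ η⁻¹ * R ^ 2 := mul_le_mul_of_nonneg_left hθ (by positivity)
    have h4 : 0 ≤ ∑ c, θ c ^ 2 := sum_nonneg fun c _ => sq_nonneg _
    have hQn : Q n = ∑ c, (∑ j, (n j : ℝ) * b j c) ^ 2 := rfl
    rw [← hQn] at h1
    have h5 := mul_le_mul_of_nonneg_left h1 ha.le
    have h6 := mul_le_mul_of_nonneg_left h2 ha.le
    have h7 := mul_le_mul_of_nonneg_left h3 ha.le
    have h8 := mul_nonneg ha.le h4
    linarith only [h5, h6, h7, h8]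
  have hlow : ∀ n : Fin k → ℤ, Real.exp (-(a / 2 * ((1 + η⁻¹) * R ^ 2))) *
      Real.exp (-(a * (1 + η) / 2) * Q n) ≤
        Real.exp (-(a / 2) * ∑ c, (θ' c + ∑ j, (n j : ℝ) * b j c) ^ 2) := by
    intro n
    rw [← Real.exp_add, hexpand]
    refine Real.exp_le_exp.2 ?_
    have h1 := two_abs_inner_le η hηpos θ' (fun c => ∑ j, (n j : ℝ) * b j c)
    have h2 := le_abs_self (∑ c, θ' c * ∑ j, (n j : ℝ) * b j c)
    have h3 : η⁻¹ * ∑ c, θ' c ^ 2 ≤ η⁻¹ * R ^ 2 := mul_le_mul_of_nonneg_left hθ' (by positivity)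
    have hQn : Q n = ∑ c, (∑ j, (n j : ℝ) * b j c) ^ 2 := rfl
    rw [← hQn] at h1
    have h5 := mul_le_mul_of_nonneg_left h1 ha.le
    have h6 := mul_le_mul_of_nonneg_left h2 ha.le
    have h7 := mul_le_mul_of_nonneg_left h3 ha.le
    have h9 := mul_le_mul_of_nonneg_left hθ' ha.le
    linarith only [h5, h6, h7, h9]
  -- summed sandwich
  have hs_lo : Summable fun n : Fin k → ℤ => Real.exp (-(a * (1 - η) / 2) * Q n) :=
    hsum (a * (1 - η)) (mul_pos ha (by linarith only [hηhalf]))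
  have hs_hi : Summable fun n : Fin k → ℤ => Real.exp (-(a * (1 + η) / 2) * Q n) :=
    hsum (a * (1 + η)) (by positivity)
  have hUP : ∑' n : Fin k → ℤ, Real.exp (-(a / 2) * ∑ c, (θ c + ∑ j, (n j : ℝ) * b j c) ^ 2) ≤
      Real.exp (a / 2 * (η⁻¹ * R ^ 2)) * ∑' n : Fin k → ℤ, Real.exp (-(a * (1 - η) / 2) * Q n) := by
    rw [← tsum_mul_left]
    exact Summable.tsum_le_tsum hup hsθ (hs_lo.mul_left _)
  have hLOW : Real.exp (-(a / 2 * ((1 + η⁻¹) * R ^ 2))) *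
      ∑' n : Fin k → ℤ, Real.exp (-(a * (1 + η) / 2) * Q n) ≤
        ∑' n : Fin k → ℤ, Real.exp (-(a / 2) * ∑ c, (θ' c + ∑ j, (n j : ℝ) * b j c) ^ 2) := by
    rw [← tsum_mul_left]
    exact Summable.tsum_le_tsum hlow (hs_hi.mul_left _) hsθ'
  -- shift from `a(1-η)` to `a(1+η)`
  have hshift := latticeTheta_shift k b hb (a * (1 - η)) (2 * a * η) (κ / a)
    (mul_pos ha (by linarith only [hηhalf])) (by positivity)
  have hst : a * (1 - η) + 2 * a * η = a * (1 + η) := by ring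
  have hE1 : 2 * a * η / 2 * (κ / a) = η * κ := by field_simp
  have hE2 : a * (1 - η) / 4 * (κ / a) = (1 - η) * κ / 4 := by field_simp
  rw [hst, hE1, hE2] at hshift
  -- assemble
  have hT1nn : 0 ≤ ∑' n : Fin k → ℤ, Real.exp (-(a * (1 - η) / 2) * Q n) :=
    tsum_nonneg fun n => (Real.exp_pos _).le
  have hT2nn : 0 ≤ ∑' n : Fin k → ℤ, Real.exp (-(a * (1 + η) / 2) * Q n) :=
    tsum_nonneg fun n => (Real.exp_pos _).le
  have hΘ2nn : 0 ≤ ∑' n : Fin k → ℤ, Real.exp (-(a / 2) * ∑ c, (θ' c + ∑ j, (n j : ℝ) * b j c) ^ 2) :=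
    tsum_nonneg fun n => (Real.exp_pos _).le
  have hc0 : 0 ≤ 2 ^ k * Real.exp (a * (1 - η) / 4 * Bc) * Real.exp (-((1 - η) * κ / 4)) := by
    positivity
  -- `(1 - δ/8) T1 ≤ (1 + δ/8) T2`
  have hT12 : (1 - δ / 8) * ∑' n : Fin k → ℤ, Real.exp (-(a * (1 - η) / 2) * Q n) ≤
      (1 + δ / 8) * ∑' n : Fin k → ℤ, Real.exp (-(a * (1 + η) / 2) * Q n) := by
    calc (1 - δ / 8) * ∑' n : Fin k → ℤ, Real.exp (-(a * (1 - η) / 2) * Q n)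
        ≤ (1 - 2 ^ k * Real.exp (a * (1 - η) / 4 * Bc) * Real.exp (-((1 - η) * κ / 4))) *
            ∑' n : Fin k → ℤ, Real.exp (-(a * (1 - η) / 2) * Q n) :=
          mul_le_mul_of_nonneg_right (by linarith only [hsmall, hc0]) hT1nn
      _ ≤ Real.exp (η * κ) * ∑' n : Fin k → ℤ, Real.exp (-(a * (1 + η) / 2) * Q n) := hshift
      _ ≤ (1 + δ / 8) * ∑' n : Fin k → ℤ, Real.exp (-(a * (1 + η) / 2) * Q n) :=
          mul_le_mul_of_nonneg_right hηκ' hT2nn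
  -- `T2 ≤ e₂ Θ2`
  have hLOW' : ∑' n : Fin k → ℤ, Real.exp (-(a * (1 + η) / 2) * Q n) ≤
      Real.exp (a / 2 * ((1 + η⁻¹) * R ^ 2)) *
        ∑' n : Fin k → ℤ, Real.exp (-(a / 2) * ∑ c, (θ' c + ∑ j, (n j : ℝ) * b j c) ^ 2) := by
    have hmul := mul_le_mul_of_nonneg_left hLOW (Real.exp_pos (a / 2 * ((1 + η⁻¹) * R ^ 2))).le
    rwa [← mul_assoc, ← Real.exp_add, add_neg_cancel, Real.exp_zero, one_mul] at hmul
  -- chain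
  refine le_of_mul_le_mul_left ?_ hδ8
  calc (1 - δ / 8) * ∑' n : Fin k → ℤ, Real.exp (-(a / 2) * ∑ c, (θ c + ∑ j, (n j : ℝ) * b j c) ^ 2)
      ≤ (1 - δ / 8) * (Real.exp (a / 2 * (η⁻¹ * R ^ 2)) *
          ∑' n : Fin k → ℤ, Real.exp (-(a * (1 - η) / 2) * Q n)) :=
        mul_le_mul_of_nonneg_left hUP hδ8.le
    _ = Real.exp (a / 2 * (η⁻¹ * R ^ 2)) *
          ((1 - δ / 8) * ∑' n : Fin k → ℤ, Real.exp (-(a * (1 - η) / 2) * Q n)) := by ring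
    _ ≤ Real.exp (a / 2 * (η⁻¹ * R ^ 2)) *
          ((1 + δ / 8) * ∑' n : Fin k → ℤ, Real.exp (-(a * (1 + η) / 2) * Q n)) :=
        mul_le_mul_of_nonneg_left hT12 (Real.exp_pos _).le
    _ ≤ Real.exp (a / 2 * (η⁻¹ * R ^ 2)) *
          ((1 + δ / 8) * (Real.exp (a / 2 * ((1 + η⁻¹) * R ^ 2)) *
            ∑' n : Fin k → ℤ, Real.exp (-(a / 2) * ∑ c, (θ' c + ∑ j, (n j : ℝ) * b j c) ^ 2))) :=
        mul_le_mul_of_nonneg_left (mul_le_mul_of_nonneg_left hLOW' (by linarith only [hδ])) (Real.exp_pos _).le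
    _ = (Real.exp (a / 2 * (η⁻¹ * R ^ 2)) * Real.exp (a / 2 * ((1 + η⁻¹) * R ^ 2))) * (1 + δ / 8) *
          ∑' n : Fin k → ℤ, Real.exp (-(a / 2) * ∑ c, (θ' c + ∑ j, (n j : ℝ) * b j c) ^ 2) := by ring
    _ ≤ (1 + δ / 8) * (1 + δ / 8) *
          ∑' n : Fin k → ℤ, Real.exp (-(a / 2) * ∑ c, (θ' c + ∑ j, (n j : ℝ) * b j c) ^ 2) :=
        mul_le_mul_of_nonneg_right (mul_le_mul_of_nonneg_right hRR (by linarith only [hδ])) hΘ2nn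
    _ ≤ (1 - δ / 8) * ((1 + δ) *
          ∑' n : Fin k → ℤ, Real.exp (-(a / 2) * ∑ c, (θ' c + ∑ j, (n j : ℝ) * b j c) ^ 2)) := by
        rw [← mul_assoc]
        exact mul_le_mul_of_nonneg_right h6 hΘ2nn

/-- **Flatness of the lattice theta sum.** For a basis `b` of `ℝᵏ`, a radius `R` and `δ > 0`
there is `a₀ > 0` such that for all `0 < a ≤ a₀` and all centres `θ, θ'` with `|θ|², |θ'|² ≤ R²`,
`Σ_n e^{−(a/2)|θ + Σ_j n_j b_j|²} ≤ (1 + δ) Σ_n e^{−(a/2)|θ' + Σ_j n_j b_j|²}`: the Gaussian prior of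
width `a^{-1/2} → ∞` folded over the lattice `Σ_j ℤ b_j` becomes flat on bounded sets (sandwich
between centred sums at `a(1 ± η)` by Cauchy–Schwarz, then a split of the centred sum at `Q ≤ κ/a`
with the tail controlled by the doubling bound). [folklore] -/
theorem latticeTheta_flat :
    ∀ (k : ℕ) (b : Fin k → Fin k → ℝ), LinearIndependent ℝ b → ∀ R δ : ℝ, 0 < δ → ∃ a₀ : ℝ, 0 < a₀ ∧ ∀ a : ℝ, 0 < a → a ≤ a₀ → ∀ θ θ' : Fin k → ℝ, ∑ c : Fin k, θ c ^ 2 ≤ R ^ 2 → ∑ c : Fin k, θ' c ^ 2 ≤ R ^ 2 → ∑' n : Fin k → ℤ, Real.exp (-(a / 2) * ∑ c : Fin k, (θ c + ∑ j : Fin k, (n j : ℝ) * b j c) ^ 2) ≤ (1 + δ) * ∑' n : Fin k → ℤ, Real.exp (-(a / 2) * ∑ c : Fin k, (θ' c + ∑ j : Fin k, (n j : ℝ) * b j c) ^ 2) := by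
  intro k b hb R δ hδ
  by_cases hδ1 : δ ≤ 1
  · exact latticeTheta_flat_aux b hb R δ hδ hδ1
  · obtain ⟨a₀, ha₀, h⟩ := latticeTheta_flat_aux b hb R 1 one_pos le_rfl
    refine ⟨a₀, ha₀, fun a ha haa θ θ' hθ hθ' => (h a ha haa θ θ' hθ hθ').trans ?_⟩
    have hT := (latticeTheta_pos k b hb a ha θ').le
    nlinarith [not_le.1 hδ1]

end Summit.QuantumFields.YangMills.Theorems.AnchorGap

end
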